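import Summits.CriticalPhenomena.PercolationContinuityZ3.Theorems.PercNearOneGluingNoHeavyLowerTailSahiCombJunta

/-!
# `NoHeavyLowerTail` (crux stmt-CriticalPhenomena-4575), Sahi's `C₃` at the comb level: BLOCK SUBSTITUTION —
# monotone Boolean combinations of independent block events inherit (M⁺-3) from the small cube of patterns

Support file (cell `prim-l12`, seat P3, gen 2; `--supports stmt-CriticalPhenomena-4575`).  No `sorry`, no named facts, standard axioms.

Setting.  `r` increasing events `X_0,…,X_{r−1} ⊆ 2^ι` determined by PAIRWISE DISJOINT coordinate sets `S_j` (independent blocks), and three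
increasing PATTERNS `Φ_0, Φ_1, Φ_2 ⊆ 2^{Fin r}`.  The substituted events are `U_i = subst X Φ_i = {ω | {j | ω ∈ X_j} ∈ Φ_i}` (increasing).
* `pushWeight_bits` — the law of the bit vector `ω ↦ {j | ω ∈ X_j}` under `μ_p` is the PRODUCT weight on `2^{Fin r}` with parameters
  `x_j(p) = μ_p(X_j)` (iterated independence over disjoint supports, `prodBernoulli_real_inter_biInter_of_determinedBy`);
* `sahiE_subst` — hence `E₃(μ_p; 1_{U_0},1_{U_1},1_{U_2}) = E₃(μ_{x(p)}; 1_{Φ_0},1_{Φ_1},1_{Φ_2})` (`sahiE_pushWeight`);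
* **`combPos_sahiE_three_subst`** — if `E₃(1_Φ)` is comb-positive on the cube `Fin r` (e.g. `r ≤ 3`: kernel certificate `…SahiC3CombCube`;
  `r ≤ 4` with the computational `…CubeFour`), then `E₃(1_U)` is comb-positive on `ι`: substitute the comb-positive, `S_j`-supported block
  probabilities `x_j(p)`, `1 − x_j(p)` into the nonnegative tensor-Bernstein representation; the multidegrees `3·1_{S_j}` add up to `≤ 3` by
  disjointness.  **`combPos_sahiE_three_subst_le_three`**: unconditional for `r ≤ 3`.
So every triple of the form (monotone functions of ≤ 3 independent increasing block events) satisfies (M⁺-3) in every dimension — in particular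
the blow-ups `(X∪Y, X∪Z, Y∪Z)` of the one hard-core triple `({a,b},{a,c},{b,c})` on three coordinates (MEMO-P3-AD §11–12), and the
strata R3/R6 of `…SahiCombStrata` (independent member / disjoint supports) as the patterns with `r ≤ 3` trivial blocks.
-/

noncomputable section

open scoped Classical

namespace Summit.CriticalPhenomena.PercolationContinuityZ3.Theorems

namespace SahiCombSubstitution

open Finset Function
open Literature.Combinatorics.Sahi2008
open Literature.Probability.LatticeModels (prodBernoulli prodBernoulli_real_inter_biInter_of_determinedBy)
open Literature.Probability.Percolation (DeterminedBy determinedBy_iff)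
open Literature.Probability.Percolation.DecisionTree (ind ind_of_mem ind_of_not_mem ind_nonneg)
open Literature.Probability.Percolation.BHK2006 (weight)
open SahiComb

variable {ι : Type} [Fintype ι] {r : ℕ}

/-! ### Substituted events and block parameters -/

omit [Fintype ι] in
/-- The bit vector of a family of events at a configuration. [this work] -/
def bits (X : Fin r → Set (Set ι)) (ω : Set ι) : Set (Fin r) := {j | ω ∈ X j}

omit [Fintype ι] in
/-- The event obtained by substituting the events `X_j` into the pattern `Φ ⊆ 2^{Fin r}`. [this work] -/
def subst (X : Fin r → Set (Set ι)) (Φ : Set (Set (Fin r))) : Set (Set ι) := {ω | bits X ω ∈ Φ}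

omit [Fintype ι] in
/-- Indicators of substituted events factor through the bit vector. [this work] -/
theorem ind_subst (X : Fin r → Set (Set ι)) (Φ : Set (Set (Fin r))) : ind (subst X Φ) = ind Φ ∘ bits X := by
  funext ω
  by_cases h : bits X ω ∈ Φ
  · rw [ind_of_mem (show ω ∈ subst X Φ from h)]; exact (ind_of_mem h).symm
  · rw [ind_of_not_mem (show ω ∉ subst X Φ from h)]; exact (ind_of_not_mem h).symm

omit [Fintype ι] in
/-- Substituting increasing events into an increasing pattern gives an increasing event. [this work] -/
theorem isUpperSet_subst {X : Fin r → Set (Set ι)} (hX : ∀ j, IsUpperSet (X j)) {Φ : Set (Set (Fin r))} (hΦ : IsUpperSet Φ) :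
    IsUpperSet (subst X Φ) :=
  fun _ _ hle hω => hΦ (fun j hj => hX j hle hj) hω

/-- `0 ≤ μ_p(X) ≤ 1`. [folklore] -/
theorem ex_ind_mem_unitInterval (p : ι → unitInterval) (X : Set (Set ι)) : ex (bernoulliWeight p) (ind X) ∈ unitInterval := by
  refine ⟨(combPos_ex_ind X).nonneg p, ?_⟩
  have h := (combPos_one_sub_ex_ind X).nonneg p
  linarith

/-- The block parameters `x_j(p) = μ_p(X_j)`. [this work] -/
def blockParam (p : ι → unitInterval) (X : Fin r → Set (Set ι)) : Fin r → unitInterval :=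
  fun j => ⟨ex (bernoulliWeight p) (ind (X j)), ex_ind_mem_unitInterval p (X j)⟩

/-- **Law of the bit vector**: with pairwise disjoint supports, the push-forward of `μ_p` along `bits X` is the product weight with the block
parameters. [this work] -/
theorem pushWeight_bits (p : ι → unitInterval) (X : Fin r → Set (Set ι)) (S : Fin r → Finset ι)
    (hS : (Set.univ : Set (Fin r)).PairwiseDisjoint S) (hXd : ∀ j, DeterminedBy (X j) (↑(S j) : Set ι)) :
    pushWeight (bernoulliWeight p) (bits X) = bernoulliWeight (blockParam p X) := by
  funext η
  rw [pushWeight_eq_ex]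
  -- the fibre `{bits X = η}` is the intersection of `X_j` (`j ∈ η`) and `X_jᶜ` (`j ∉ η`)
  set C : Fin r → Set (Set ι) := fun j => if j ∈ η then X j else (X j)ᶜ with hC
  have hfib : (fun ω => if bits X ω = η then (1 : ℝ) else 0) = ind (Set.univ ∩ ⋂ j ∈ (Finset.univ : Finset (Fin r)), C j) := by
    funext ω
    have key : bits X ω = η ↔ ω ∈ Set.univ ∩ ⋂ j ∈ (Finset.univ : Finset (Fin r)), C j := by
      simp only [Set.mem_inter_iff, Set.mem_univ, true_and, Set.mem_iInter, Finset.mem_univ, forall_true_left, hC]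
      constructor
      · rintro rfl j
        by_cases hj : ω ∈ X j
        · have : j ∈ bits X ω := hj
          simp [this, hj]
        · have : j ∉ bits X ω := hj
          simp [this, hj]
      · intro h
        ext j
        have hj := h j
        constructor
        · intro hω
          by_contra hjη
          simp only [hjη, if_false, Set.mem_compl_iff] at hj
          exact hj hω
        · intro hjη
          simp only [hjη, if_true] at hj
          exact hj
    by_cases hω : bits X ω = η
    · rw [if_pos hω, ind_of_mem (key.1 hω)]
    · rw [if_neg hω, ind_of_not_mem fun h' => hω (key.2 h')]
  rw [hfib, ex_bernoulliWeight_ind]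
  have hSd : ((Finset.univ : Finset (Fin r)) : Set (Fin r)).PairwiseDisjoint S := by simpa using hS
  have hCd : ∀ j ∈ (Finset.univ : Finset (Fin r)), DeterminedBy (C j) (↑(S j) : Set ι) := fun j _ => by
    by_cases hj : j ∈ η
    · simp only [hC, hj, if_true]; exact hXd j
    · simp only [hC, hj, if_false]
      -- the complement of an `S j`-determined event is `S j`-determined
      have hA := (determinedBy_iff _ _).1 (hXd j)
      rw [determinedBy_iff]
      intro ω ω' h
      rw [Set.mem_compl_iff, Set.mem_compl_iff, hA ω ω' h]
  have huniv : DeterminedBy (Set.univ : Set (Set ι)) (⋃ j ∈ (Finset.univ : Finset (Fin r)), (↑(S j) : Set ι))ᶜ := by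
    rw [determinedBy_iff]; intro ω ω' _; simp
  rw [prodBernoulli_real_inter_biInter_of_determinedBy p Finset.univ S hSd hCd (fun _ _ => MeasurableSet.of_discrete) huniv
    MeasurableSet.of_discrete]
  simp only [MeasureTheory.probReal_univ, one_mul, bernoulliWeight, weight]
  refine Finset.prod_congr rfl fun j _ => ?_
  by_cases hj : j ∈ η
  · simp only [hC, hj, if_true, blockParam, ex_bernoulliWeight_ind]
  · simp only [hC, hj, if_false, blockParam]
    rw [MeasureTheory.probReal_compl_eq_one_sub MeasurableSet.of_discrete, ex_bernoulliWeight_ind]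

/-- **`E₃` of substituted events is `E₃` of the patterns under the block-parameter product weight.** [this work] -/
theorem sahiE_subst (p : ι → unitInterval) (X : Fin r → Set (Set ι)) (S : Fin r → Finset ι)
    (hS : (Set.univ : Set (Fin r)).PairwiseDisjoint S) (hXd : ∀ j, DeterminedBy (X j) (↑(S j) : Set ι)) (k : ℕ)
    (Φ : Fin k → Set (Set (Fin r))) :
    sahiE (bernoulliWeight p) k (fun i => ind (subst X (Φ i))) = sahiE (bernoulliWeight (blockParam p X)) k (fun i => ind (Φ i)) := by
  have hfun : (fun i => ind (subst X (Φ i))) = fun i => ind (Φ i) ∘ bits X := funext fun i => ind_subst X (Φ i)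
  rw [hfun, ← pushWeight_bits p X S hS hXd, sahiE_pushWeight]

/-! ### Comb positivity of block probabilities, supported on the block -/

/-- Killing the multidegree at a set of ignored coordinates. [this work] -/
theorem CombPos.of_ignores_finset {c : ι → ℕ} {F : (ι → unitInterval) → ℝ} (R : Finset ι)
    (hF : ∀ e ∈ R, ∀ p s, F (update p e s) = F p) (h : CombPos c F) :
    CombPos (fun e => if e ∈ R then 0 else c e) F := by
  induction R using Finset.induction_on with
  | empty => simpa using h
  | insert a R haR ih =>
    have h1 := ih fun e he => hF e (Finset.mem_insert_of_mem he)
    have h2 := h1.of_ignores a (hF a (Finset.mem_insert_self a R))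
    refine (show (update (fun e => if e ∈ R then 0 else c e) a 0) = fun e => if e ∈ insert a R then 0 else c e from ?_) ▸ h2
    funext e
    by_cases he : e = a
    · subst he; simp
    · simp [he]

/-- The probability of an `S`-determined event is comb-positive with multidegree `1` on `S` and `0` elsewhere. [this work] -/
theorem combPos_ex_ind_supported (S : Finset ι) {X : Set (Set ι)} (hXd : DeterminedBy X (↑S : Set ι)) :
    CombPos (fun e => if e ∈ S then 1 else 0) (fun p => ex (bernoulliWeight p) (ind X)) := by
  have h := CombPos.of_ignores_finset (Finset.univ \ S) (fun e he p s =>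
    SahiCombJunta.ex_ind_update_of_determinedBy p e s hXd (by simpa using he)) (combPos_ex_ind X)
  refine (show (fun e => if e ∈ Finset.univ \ S then 0 else (1 : ℕ)) = fun e => if e ∈ S then 1 else 0 from ?_) ▸ h
  funext e; by_cases he : e ∈ S <;> simp [he]

/-- Likewise for `1 − μ_p(X)`. [this work] -/
theorem combPos_one_sub_ex_ind_supported (S : Finset ι) {X : Set (Set ι)} (hXd : DeterminedBy X (↑S : Set ι)) :
    CombPos (fun e => if e ∈ S then 1 else 0) (fun p => 1 - ex (bernoulliWeight p) (ind X)) := by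
  have h := CombPos.of_ignores_finset (Finset.univ \ S) (fun e he p s => by
    rw [SahiCombJunta.ex_ind_update_of_determinedBy p e s hXd (by simpa using he)]) (combPos_one_sub_ex_ind X)
  refine (show (fun e => if e ∈ Finset.univ \ S then 0 else (1 : ℕ)) = fun e => if e ∈ S then 1 else 0 from ?_) ▸ h
  funext e; by_cases he : e ∈ S <;> simp [he]

/-- Powers of comb-positive functions. [folklore] -/
theorem CombPos.pow {c : ι → ℕ} {F : (ι → unitInterval) → ℝ} (h : CombPos c F) :
    ∀ n : ℕ, CombPos (fun e => n * c e) (fun p => F p ^ n)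
  | 0 => (combPos_one _).congr fun p => by simp
  | n + 1 => by
    have := (CombPos.pow h n).mul h
    refine (show ((fun e => n * c e) + c) = fun e => (n + 1) * c e from ?_) ▸ (this.congr fun p => by ring)
    funext e; simp only [Pi.add_apply]; ring

/-- Finite products of comb-positive functions. [folklore] -/
theorem CombPos.finset_prod {κ : Type*} (s : Finset κ) {c : κ → ι → ℕ} {F : κ → (ι → unitInterval) → ℝ}
    (h : ∀ j ∈ s, CombPos (c j) (F j)) : CombPos (fun e => ∑ j ∈ s, c j e) (fun p => ∏ j ∈ s, F j p) := by
  induction s using Finset.induction_on with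
  | empty => exact (combPos_one _).congr fun p => by simp
  | insert a s has ih =>
    have h1 := (h a (Finset.mem_insert_self a s)).mul (ih fun j hj => h j (Finset.mem_insert_of_mem hj))
    refine (show (c a + fun e => ∑ j ∈ s, c j e) = fun e => ∑ j ∈ insert a s, c j e from ?_) ▸
      (h1.congr fun p => by rw [Finset.prod_insert has])
    funext e; simp [Finset.sum_insert has]

omit [Fintype ι] in
/-- With pairwise disjoint blocks, the block multidegrees `3·1_{S_j}` add up to at most `3`. [this work] -/
theorem sum_block_degree_le (S : Fin r → Finset ι) (hS : (Set.univ : Set (Fin r)).PairwiseDisjoint S) (e : ι) :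
    (∑ j : Fin r, if e ∈ S j then 3 else 0) ≤ 3 := by
  by_cases h : ∃ j, e ∈ S j
  · obtain ⟨j₀, hj₀⟩ := h
    have hothers : ∀ j, j ≠ j₀ → e ∉ S j := fun j hj he =>
      Finset.disjoint_left.1 (hS (Set.mem_univ j) (Set.mem_univ j₀) hj) he hj₀
    rw [Finset.sum_eq_single j₀ (fun j _ hj => by rw [if_neg (hothers j hj)]) (fun h => absurd (Finset.mem_univ _) h), if_pos hj₀]
  · simp only [not_exists] at h
    rw [Finset.sum_eq_zero fun j _ => by rw [if_neg (h j)]]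
    omega

/-! ### The substitution theorem -/

/-- **Block substitution.**  If the patterns' `E₃` is comb-positive on the cube `Fin r`, then `E₃` of the substituted events is comb-positive
on `ι` (pairwise disjoint supports; `X_j` increasing is not even needed for this transfer). [this work] -/
theorem combPos_sahiE_three_subst (X : Fin r → Set (Set ι)) (S : Fin r → Finset ι) (hS : (Set.univ : Set (Fin r)).PairwiseDisjoint S)
    (hXd : ∀ j, DeterminedBy (X j) (↑(S j) : Set ι)) (Φ : Fin 3 → Set (Set (Fin r)))
    (h : CombPos (fun _ : Fin r => 3) (fun q => sahiE (bernoulliWeight q) 3 (fun i => ind (Φ i)))) :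
    CombPos (fun _ : ι => 3) (fun p => sahiE (bernoulliWeight p) 3 (fun i => ind (subst X (Φ i)))) := by
  obtain ⟨N, hN, hrep⟩ := h
  -- each basis function of the block parameters is comb-positive with multidegree `Σ_j 3·1_{S_j}`
  have hfac : ∀ k : Fin r → ℕ, k ∈ box (fun _ : Fin r => 3) → CombPos (fun e => ∑ j : Fin r, if e ∈ S j then 3 else 0)
      (fun p => bern (fun _ : Fin r => 3) k (blockParam p X)) := by
    intro k hk
    have hkj : ∀ j, k j ≤ 3 := fun j => mem_box.1 hk j
    have hj : ∀ j ∈ (Finset.univ : Finset (Fin r)), CombPos (fun e => if e ∈ S j then 3 else 0)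
        (fun p => (ex (bernoulliWeight p) (ind (X j))) ^ (k j) * (1 - ex (bernoulliWeight p) (ind (X j))) ^ (3 - k j)) := by
      intro j _
      have h1 := (CombPos.pow (combPos_ex_ind_supported (S j) (hXd j)) (k j)).mul
        (CombPos.pow (combPos_one_sub_ex_ind_supported (S j) (hXd j)) (3 - k j))
      refine (show ((fun e => k j * (if e ∈ S j then 1 else 0)) + fun e => (3 - k j) * (if e ∈ S j then 1 else 0)) =
          fun e => if e ∈ S j then 3 else 0 from ?_) ▸ h1
      funext e
      simp only [Pi.add_apply]
      have := hkj j
      by_cases he : e ∈ S j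
      · simp [he]; omega
      · simp [he]
    refine (CombPos.finset_prod Finset.univ hj).congr fun p => ?_
    unfold bern
    rfl
  have hterm : ∀ k ∈ box (fun _ : Fin r => 3), CombPos (fun _ : ι => 3)
      (fun p => N k * bern (fun _ : Fin r => 3) k (blockParam p X)) := fun k hk =>
    (((hfac k hk).mono fun e => sum_block_degree_le S hS e).smul (hN k)).congr fun p => by ring
  refine (CombPos.sum _ hterm).congr fun p => ?_
  rw [sahiE_subst p X S hS hXd 3 Φ]
  exact hrep (blockParam p X)

/-- **Block substitution, unconditionally for at most three blocks** (kernel certificate `…SahiC3CombCube`): monotone combinations of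
`r ≤ 3` increasing events with pairwise disjoint supports satisfy (M⁺-3), in every dimension. [this work] -/
theorem combPos_sahiE_three_subst_le_three (hr : r ≤ 3) (X : Fin r → Set (Set ι)) (S : Fin r → Finset ι)
    (hS : (Set.univ : Set (Fin r)).PairwiseDisjoint S) (hXd : ∀ j, DeterminedBy (X j) (↑(S j) : Set ι))
    (Φ : Fin 3 → Set (Set (Fin r))) (hΦ : ∀ i, IsUpperSet (Φ i)) :
    CombPos (fun _ : ι => 3) (fun p => sahiE (bernoulliWeight p) 3 (fun i => ind (subst X (Φ i)))) :=
  combPos_sahiE_three_subst X S hS hXd Φ ((ThreePartition.combPos_vec_iff Φ).2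
    (SahiC3CombCube.combPos_sahiE_three_of_card_le_three (by simpa using hr) (hΦ 0) (hΦ 1) (hΦ 2)))

/-- Law level: `E₃(μ_p) ≥ 0` for monotone combinations of at most three independent increasing block events. [this work] -/
theorem sahiE_three_subst_nonneg_le_three (p : ι → unitInterval) (hr : r ≤ 3) (X : Fin r → Set (Set ι)) (S : Fin r → Finset ι)
    (hS : (Set.univ : Set (Fin r)).PairwiseDisjoint S) (hXd : ∀ j, DeterminedBy (X j) (↑(S j) : Set ι))
    (Φ : Fin 3 → Set (Set (Fin r))) (hΦ : ∀ i, IsUpperSet (Φ i)) :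
    0 ≤ sahiE (bernoulliWeight p) 3 (fun i => ind (subst X (Φ i))) :=
  (combPos_sahiE_three_subst_le_three hr X S hS hXd Φ hΦ).nonneg p

/-- (★★) for substituted triples: `threePartNT τ ≥ 0`, every twist, for monotone combinations of `≤ 3` independent increasing block events.
[this work] -/
theorem threePartNT_subst_nonneg_le_three (τ : Set ι) (hr : r ≤ 3) (X : Fin r → Set (Set ι)) (S : Fin r → Finset ι)
    (hS : (Set.univ : Set (Fin r)).PairwiseDisjoint S) (hXd : ∀ j, DeterminedBy (X j) (↑(S j) : Set ι))
    (Φ : Fin 3 → Set (Set (Fin r))) (hΦ : ∀ i, IsUpperSet (Φ i)) :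
    0 ≤ ThreePartition.threePartNT τ (subst X (Φ 0)) (subst X (Φ 1)) (subst X (Φ 2)) :=
  ThreePartition.threePartNT_nonneg_of_combPos τ ((ThreePartition.combPos_vec_iff (fun i => subst X (Φ i))).1
    (combPos_sahiE_three_subst_le_three hr X S hS hXd Φ hΦ))

end SahiCombSubstitution

end Summit.CriticalPhenomena.PercolationContinuityZ3.Theorems
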